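import Summits.QuantumFields.BalabanUV.Beta.FP.ColourDoubling

/-!
# `BalabanUV.Beta.FP.ColourDoublingKkt` — road «FP» for binder row D1, ROUTE T, option (δ) «LIFT» (F-FP-18-3 ∕ W-FP-18-8 ∕ W-FP-18-9; an3 g95 W-1):
# **STRIP-BACK FOR BORDERED SYSTEMS — the one-loop functional of a LIFTED bordered 2-jet is `tr(c·c)` times the functional of the
# SIGN-TWISTED stripped bordered 2-jet `(kkt K₀ C₀, [[K₁, −C₁ᵀ],[C₁, 0]], kkt K₂ C₂)`**

WHY.  Under (δ) every torus call of the (T-INST-j) chain is instantiated at LIFTED blocks (`1 ⊗ x₀`, `c ⊗ x₁`, `(c·c) ⊗ x₂`, `cᵀ = −c`;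
`D1BFx.ColourLift`); its conclusion is a three-term law among `secondVar`s of lifted BORDERED systems `kkt (cⁿ ⊗ Kₙ) [cⁿ ⊗ Qₙ; cⁿ ⊗ Tₙ]`.  The END of
record consumes STRIPPED numbers in the convention of record (an3: `StepJetData` §5, `mfNeg` placement = convention (−)).  This file is the [folklore]
bookkeeping that strips a lifted bordered law back: by `ColourLift.kkt_kronecker` the ordinary `kkt` at lifted blocks is the `e₃`-re-indexed lift of the
SIGNED stripped bordered matrix — sign `+` at even orders, sign `−` at odd orders (the transpose of `c ⊗ Q₁` is `−c ⊗ Q₁ᵀ`) — so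
* `secondVar_reindex` (from `ColourLift.mixedVar_reindex`);
* `kkt_signTwist : fromBlocks K (−Cᵀ) C 0 = kkt K C * fromBlocks 1 0 0 (−1)` (the (−)-placed bordered jet, written without a definition),
  `signTwist_transpose` (it is antisymmetric when `K` is);
* `secondVar_kkt_lift_strip (hc : cᵀ = −c)` :
  `secondVar (kkt (1⊗K₀) [1⊗Q₀; 1⊗T₀]) (kkt (c⊗K₁) [c⊗Q₁; c⊗T₁]) (kkt ((c·c)⊗K₂) [(c·c)⊗Q₂; (c·c)⊗T₂])`
  `= tr(c·c) · secondVar (kkt K₀ [Q₀;T₀]) (fromBlocks K₁ (−[Q₁;T₁]ᵀ) [Q₁;T₁] 0) (kkt K₂ [Q₂;T₂])` — for ANY blocks (no invertibility, parity or Ward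
  hypothesis); `_cgen` instance (factor `−2`); `_zeroSlice` variant for the shapes `fromRows Qₙ 0` of p308750's conclusion;
* `secondVar_cgen_kkt_law_iff` : a three-term law among lifted bordered systems ↔ the same law among the (−)-placed stripped ones.
Nothing of the dictionary asserted; the census of which typed instances are (+)-placed is the owner's journal word W-FP-18-9 (1), not a theorem.

HONEST DEPENDENCY (page 1, mandatory): continuum YM on T⁴ ⇐ BetaPertH ∧ nine spine estimates (0/9 proved); BetaPertH ⇐ (D1) ∧ (D4) ∧ CAP+tail;
G-an2-4 gates asym, D1 and NE2/3/4.  HONEST FRAMING (cell contract, verbatim): «discharging `BetaPertH` makes Bałaban's UV stability UNCONDITIONAL —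
a real constructive-QFT result; it is NOT the continuum limit and NOT the Clay problem.»  ABSOLUTE RULE (cell charter, verbatim): «No internally-minted
statement may enter as a cited fact. Every hypothesis is either kernel-proved in this package or a verbatim quotation of a PUBLISHED theorem with page
reference. The manuscript(s) under audit are NOT citable for their own disputed steps — they are the thing under adjudication; programme-internal
(2001/route/tribunal) claims are never citable.»  No `def`, no `def … : Prop`, nothing cited, 0 sorry; 0 estimates; 0∕4 row-D1 binders; NOT (T-ID),
NOT SDF, NOT D1, NOT BetaPertH, NOT continuum, NOT Clay.  Road «FP» OWNER, b2b-balaban-beta-d1-p3 gen 18, 2026-08-22.  No existing file touched.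
-/

noncomputable section

namespace Summit.QuantumFields.BalabanUV.Beta.FP.ColourDoublingKkt

open Matrix
open scoped Kronecker
open Literature.MathematicalPhysics.QuantumFieldTheory.Balaban1983to89.Beta.Composition (kkt)
open Summit.QuantumFields.BalabanUV.Beta.D1BFx.LogDetSecondVariation (secondVar)
open Summit.QuantumFields.BalabanUV.Beta.D1BFx.SliceTransferJetsMixed (mixedVar_self)
open Summit.QuantumFields.BalabanUV.Beta.D1BFx.ColourLift (cgen cgen_transpose cgen_mul_cgen trace_cgen_mul_cgen e₃ kkt_kronecker
  kkt_kronecker_symm sq_transpose mixedVar_reindex)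
open Summit.QuantumFields.BalabanUV.Beta.FP.ColourDoubling (secondVar_kronecker_lift)

variable {l ι κ ν μ ρ : Type*} [Fintype l] [Fintype ι] [Fintype κ] [Fintype ν] [Fintype μ] [Fintype ρ]
  [DecidableEq l] [DecidableEq ι] [DecidableEq κ] [DecidableEq ν] [DecidableEq μ] [DecidableEq ρ]

/-! ## §1 Re-indexing invariance and the sign-twisted bordered jet -/

omit [Fintype l] [Fintype ν] [Fintype μ] [Fintype ρ] [DecidableEq l] [DecidableEq ν] [DecidableEq μ] [DecidableEq ρ] in
/-- [folklore] `secondVar` is invariant under a simultaneous re-indexing of the three jets (`ColourLift.mixedVar_reindex` on the diagonal). -/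
theorem secondVar_reindex (e : ι ≃ κ) (A₀ A₁ A₂ : Matrix ι ι ℝ) :
    secondVar (reindex e e A₀) (reindex e e A₁) (reindex e e A₂) = secondVar A₀ A₁ A₂ := by
  rw [← mixedVar_self, ← mixedVar_self]
  exact mixedVar_reindex e A₀ A₁ A₁ A₂

omit [Fintype l] [Fintype ι] [Fintype κ] [Fintype ρ] [DecidableEq l] [DecidableEq ι] [DecidableEq κ] [DecidableEq ρ] in
/-- [folklore] **THE (−)-PLACED BORDERED JET, WITHOUT A DEFINITION**: `[[K, −Cᵀ],[C, 0]] = kkt K C · [[1, 0],[0, −1]]`. -/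
theorem kkt_signTwist (K : Matrix ν ν ℝ) (C : Matrix μ ν ℝ) :
    fromBlocks K (-Cᵀ) C 0 = kkt K C * fromBlocks (1 : Matrix ν ν ℝ) 0 0 (-1 : Matrix μ μ ℝ) := by
  rw [kkt, Matrix.fromBlocks_multiply]
  simp

omit [Fintype l] [Fintype ι] [Fintype κ] [Fintype ν] [Fintype μ] [Fintype ρ] [DecidableEq l] [DecidableEq ι] [DecidableEq κ] [DecidableEq ν]
  [DecidableEq μ] [DecidableEq ρ] in
/-- [folklore] the (−)-placed bordered jet of an ANTISYMMETRIC form block is ANTISYMMETRIC: `Kᵀ = −K ⇒ ([[K, −Cᵀ],[C, 0]])ᵀ = −[[K, −Cᵀ],[C, 0]]`. -/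
theorem signTwist_transpose {K : Matrix ν ν ℝ} (hK : Kᵀ = -K) (C : Matrix μ ν ℝ) :
    (fromBlocks K (-Cᵀ) C 0)ᵀ = -fromBlocks K (-Cᵀ) C 0 := by
  rw [Matrix.fromBlocks_transpose, Matrix.fromBlocks_neg, hK, Matrix.transpose_neg, Matrix.transpose_transpose, neg_neg,
    Matrix.transpose_zero, neg_zero]

/-! ## §2 Strip-back: lifted bordered `secondVar` = `tr(c·c)` × sign-twisted stripped bordered `secondVar` -/

/-- [folklore] **STRIP-BACK FOR THE DOUBLY BORDERED SYSTEM** (`cᵀ = −c`; ANY blocks): the ordinary `kkt` at lifted blocks is, order by order, the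
`e₃`-re-indexed lift of the stripped bordered matrix with sign `+ − +` on the upper-right border (`ColourLift.kkt_kronecker`), hence
`secondVar (lifted bordered 2-jet) = tr(c·c) · secondVar (kkt K₀ [Q₀;T₀]) ([[K₁, −[Q₁;T₁]ᵀ],[[Q₁;T₁], 0]]) (kkt K₂ [Q₂;T₂])`. -/
theorem secondVar_kkt_lift_strip {c : Matrix l l ℝ} (hc : cᵀ = -c) (K₀ K₁ K₂ : Matrix ν ν ℝ) (Q₀ Q₁ Q₂ : Matrix μ ν ℝ) (T₀ T₁ T₂ : Matrix ρ ν ℝ) :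
    secondVar (kkt ((1 : Matrix l l ℝ) ⊗ₖ K₀) (fromRows ((1 : Matrix l l ℝ) ⊗ₖ Q₀) ((1 : Matrix l l ℝ) ⊗ₖ T₀)))
        (kkt (c ⊗ₖ K₁) (fromRows (c ⊗ₖ Q₁) (c ⊗ₖ T₁)))
        (kkt ((c * c) ⊗ₖ K₂) (fromRows ((c * c) ⊗ₖ Q₂) ((c * c) ⊗ₖ T₂)))
      = (c * c).trace * secondVar (kkt K₀ (fromRows Q₀ T₀)) (fromBlocks K₁ (-(fromRows Q₁ T₁)ᵀ) (fromRows Q₁ T₁) 0) (kkt K₂ (fromRows Q₂ T₂)) := by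
  rw [kkt_kronecker_symm Matrix.transpose_one, kkt_kronecker (s := -1) (by rw [hc, neg_one_smul]), kkt_kronecker_symm (sq_transpose hc),
    neg_one_smul, secondVar_reindex, secondVar_kronecker_lift]

/-- [folklore] the same with ZERO slice rows at orders 1 and 2 (the shape `fromRows Qₙ 0` of p308750's conclusion: the slice rows are static). -/
theorem secondVar_kkt_lift_strip_zeroSlice {c : Matrix l l ℝ} (hc : cᵀ = -c) (K₀ K₁ K₂ : Matrix ν ν ℝ) (Q₀ Q₁ Q₂ : Matrix μ ν ℝ) (T₀ : Matrix ρ ν ℝ) :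
    secondVar (kkt ((1 : Matrix l l ℝ) ⊗ₖ K₀) (fromRows ((1 : Matrix l l ℝ) ⊗ₖ Q₀) ((1 : Matrix l l ℝ) ⊗ₖ T₀)))
        (kkt (c ⊗ₖ K₁) (fromRows (c ⊗ₖ Q₁) (0 : Matrix (l × ρ) (l × ν) ℝ)))
        (kkt ((c * c) ⊗ₖ K₂) (fromRows ((c * c) ⊗ₖ Q₂) (0 : Matrix (l × ρ) (l × ν) ℝ)))
      = (c * c).trace
          * secondVar (kkt K₀ (fromRows Q₀ T₀)) (fromBlocks K₁ (-(fromRows Q₁ (0 : Matrix ρ ν ℝ))ᵀ) (fromRows Q₁ (0 : Matrix ρ ν ℝ)) 0)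
              (kkt K₂ (fromRows Q₂ (0 : Matrix ρ ν ℝ))) := by
  have h := secondVar_kkt_lift_strip hc K₀ K₁ K₂ Q₀ Q₁ Q₂ T₀ 0 0
  simp only [Matrix.kronecker_zero] at h
  exact h

/-- [folklore] **AT `cgen` THE FACTOR IS `−2`.** -/
theorem secondVar_kkt_cgen_strip (K₀ K₁ K₂ : Matrix ν ν ℝ) (Q₀ Q₁ Q₂ : Matrix μ ν ℝ) (T₀ T₁ T₂ : Matrix ρ ν ℝ) :
    secondVar (kkt ((1 : Matrix (Fin 2) (Fin 2) ℝ) ⊗ₖ K₀) (fromRows ((1 : Matrix (Fin 2) (Fin 2) ℝ) ⊗ₖ Q₀) ((1 : Matrix (Fin 2) (Fin 2) ℝ) ⊗ₖ T₀)))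
        (kkt (cgen ⊗ₖ K₁) (fromRows (cgen ⊗ₖ Q₁) (cgen ⊗ₖ T₁)))
        (kkt ((cgen * cgen) ⊗ₖ K₂) (fromRows ((cgen * cgen) ⊗ₖ Q₂) ((cgen * cgen) ⊗ₖ T₂)))
      = -2 * secondVar (kkt K₀ (fromRows Q₀ T₀)) (fromBlocks K₁ (-(fromRows Q₁ T₁)ᵀ) (fromRows Q₁ T₁) 0) (kkt K₂ (fromRows Q₂ T₂)) := by
  rw [secondVar_kkt_lift_strip cgen_transpose, trace_cgen_mul_cgen]

/-! ## §3 A three-term law among lifted bordered systems ↔ the same law among the (−)-placed stripped ones -/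

/-- [folklore] **THE FINITE-`j` LAW STRIPS**: for three bordered systems (one-shot `P`, fine `T`, coarse `C`, on possibly different index types) a
three-term law `secondVar(lift P) = secondVar(lift T) + secondVar(lift C)` among the `cgen`-lifted bordered 2-jets holds iff the same law holds among
the (−)-placed STRIPPED bordered 2-jets (uniform factor `−2`). -/
theorem secondVar_cgen_kkt_law_iff
    {νP μP ρP νT μT ρT νC μC ρC : Type*} [Fintype νP] [Fintype μP] [Fintype ρP] [Fintype νT] [Fintype μT] [Fintype ρT] [Fintype νC] [Fintype μC]
    [Fintype ρC] [DecidableEq νP] [DecidableEq μP] [DecidableEq ρP] [DecidableEq νT] [DecidableEq μT] [DecidableEq ρT] [DecidableEq νC]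
    [DecidableEq μC] [DecidableEq ρC]
    (P₀ P₁ P₂ : Matrix νP νP ℝ) (A₀ A₁ A₂ : Matrix μP νP ℝ) (U₀ U₁ U₂ : Matrix ρP νP ℝ)
    (T₀ T₁ T₂ : Matrix νT νT ℝ) (B₀ B₁ B₂ : Matrix μT νT ℝ) (V₀ V₁ V₂ : Matrix ρT νT ℝ)
    (C₀ C₁ C₂ : Matrix νC νC ℝ) (D₀ D₁ D₂ : Matrix μC νC ℝ) (E₀ E₁ E₂ : Matrix ρC νC ℝ) :
    secondVar (kkt ((1 : Matrix (Fin 2) (Fin 2) ℝ) ⊗ₖ P₀) (fromRows ((1 : Matrix (Fin 2) (Fin 2) ℝ) ⊗ₖ A₀) ((1 : Matrix (Fin 2) (Fin 2) ℝ) ⊗ₖ U₀)))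
          (kkt (cgen ⊗ₖ P₁) (fromRows (cgen ⊗ₖ A₁) (cgen ⊗ₖ U₁)))
          (kkt ((cgen * cgen) ⊗ₖ P₂) (fromRows ((cgen * cgen) ⊗ₖ A₂) ((cgen * cgen) ⊗ₖ U₂)))
        = secondVar (kkt ((1 : Matrix (Fin 2) (Fin 2) ℝ) ⊗ₖ T₀) (fromRows ((1 : Matrix (Fin 2) (Fin 2) ℝ) ⊗ₖ B₀) ((1 : Matrix (Fin 2) (Fin 2) ℝ) ⊗ₖ V₀)))
            (kkt (cgen ⊗ₖ T₁) (fromRows (cgen ⊗ₖ B₁) (cgen ⊗ₖ V₁)))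
            (kkt ((cgen * cgen) ⊗ₖ T₂) (fromRows ((cgen * cgen) ⊗ₖ B₂) ((cgen * cgen) ⊗ₖ V₂)))
          + secondVar (kkt ((1 : Matrix (Fin 2) (Fin 2) ℝ) ⊗ₖ C₀) (fromRows ((1 : Matrix (Fin 2) (Fin 2) ℝ) ⊗ₖ D₀) ((1 : Matrix (Fin 2) (Fin 2) ℝ) ⊗ₖ E₀)))
              (kkt (cgen ⊗ₖ C₁) (fromRows (cgen ⊗ₖ D₁) (cgen ⊗ₖ E₁)))
              (kkt ((cgen * cgen) ⊗ₖ C₂) (fromRows ((cgen * cgen) ⊗ₖ D₂) ((cgen * cgen) ⊗ₖ E₂)))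
      ↔ secondVar (kkt P₀ (fromRows A₀ U₀)) (fromBlocks P₁ (-(fromRows A₁ U₁)ᵀ) (fromRows A₁ U₁) 0) (kkt P₂ (fromRows A₂ U₂))
          = secondVar (kkt T₀ (fromRows B₀ V₀)) (fromBlocks T₁ (-(fromRows B₁ V₁)ᵀ) (fromRows B₁ V₁) 0) (kkt T₂ (fromRows B₂ V₂))
            + secondVar (kkt C₀ (fromRows D₀ E₀)) (fromBlocks C₁ (-(fromRows D₁ E₁)ᵀ) (fromRows D₁ E₁) 0) (kkt C₂ (fromRows D₂ E₂)) := by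
  rw [secondVar_kkt_cgen_strip, secondVar_kkt_cgen_strip, secondVar_kkt_cgen_strip]
  constructor
  · intro h; linarith
  · intro h; rw [h]; ring

end Summit.QuantumFields.BalabanUV.Beta.FP.ColourDoublingKkt

end
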